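import Summits.ValiantsHypothesis.ValiantsHypothesis.Theorems.KPlusLogSqLawValuativeDoorExchange

/-!
# LINE `valuative_door` (crux `WeakLifting`, stmt-ValiantsHypothesis-19561) — VIRTUAL COEFFICIENTS of the rank-one lacunary
# determinant: exchange inequality without dissociation, class sums, ultrametric class-sum estimates

HONEST FRAMING.  Helper (cell `pub-symmetroid`, seat val-sym-lift-p1 g22, 2026-08-29; `--supports 19561 --as helper`).  For a general (not
dissociated) exponent vector `d` the coefficient of `X^E` in `det Σ_l X^{d_l} ε_l u_l u_lᵀ` is the CLASS SUM `c_E = Σ_{#S = m, E(S) = E} w_S` of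
the VIRTUAL coefficients `w_S = ε(S) · det(u_S)²` (`coeff_eq_sum_virtual`, Cauchy–Binet `det_rankOnePencil` regrouped by the selected set;
`w_S` is written def-free as the one-term sum over the strictly monotone selections of `S`).  The virtual coefficients satisfy the
valuated-matroid exchange inequality for every non-archimedean `v` with NO hypothesis on `d` (`exchange_virtual`; Grassmann–Plücker via
Cramer from `…ValuativeDoorExchange`), and ultrametric class sums obey `v(Σ) ≤ max` (`abv_sum_le_of_forall_le`) with equality at a unique
maximum (`abv_sum_eq_of_unique_max`).  Consumed by `…ValuativeDoorRankOneSharp` (`ValRankOneSharp` for injective `d`).  Nothing here is a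
stub of the line or closes anything; no bearing on vW / vB, `TropicalB`, `MatrixDescartes` (18050) or VP ≠ VNP.  [Dress–Wenzel; elementary]
-/

set_option linter.dupNamespace false
set_option autoImplicit false

namespace Summit.ValiantsHypothesis.ValiantsHypothesis.Theorems.KPlusLogSqLaw.ValDoor

open Polynomial Finset Matrix
open scoped BigOperators Classical

variable {F : Type*} [Field F]

/-! ## §1 Virtual coefficients `w_S = ε(S) · det(u_S)²` -/

/-- the strictly monotone selections with a given image: exactly the sorted one. [bookkeeping] -/
theorem filter_strictMono_image_eq_singleton {m K : ℕ} (S : Finset (Fin K)) (t₀ : Fin m → Fin K) (ht₀ : StrictMono t₀)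
    (h : univ.image t₀ = S) :
    ((univ : Finset (Fin m → Fin K)).filter fun t => StrictMono t ∧ univ.image t = S) = {t₀} := by
  ext t
  rw [Finset.mem_filter, Finset.mem_singleton]
  constructor
  · rintro ⟨-, ht, himg⟩
    exact strictMono_eq_of_image_eq ht ht₀ (himg.trans h.symm)
  · rintro rfl
    exact ⟨Finset.mem_univ _, ht₀, h⟩

/-- **valuation of a virtual coefficient:** `v(w_S) = (Π_{l∈S} v(ε_l)) · v(det u_t)²` for any injective selection `t` of `S`. [bookkeeping] -/
theorem absoluteValue_virtual (v : AbsoluteValue F ℝ) {m K : ℕ} (ε : Fin K → F) (u : Fin K → Fin m → F) {t : Fin m → Fin K}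
    (ht : Function.Injective t) :
    v (∑ t' ∈ (univ : Finset (Fin m → Fin K)).filter (fun t' => StrictMono t' ∧ univ.image t' = univ.image t),
        (∏ i, ε (t' i)) * (Matrix.det (Matrix.of fun i j => u (t' j) i)) ^ 2)
      = (∏ l ∈ univ.image t, v (ε l)) * v (Matrix.det (Matrix.of fun r c => u (t c) r)) ^ 2 := by
  have hcard : (univ.image t).card = m := by
    rw [Finset.card_image_of_injective _ ht, Finset.card_univ, Fintype.card_fin]
  obtain ⟨t₀, ht₀, himg⟩ := exists_strictMono_image_eq (univ.image t) hcard
  rw [filter_strictMono_image_eq_singleton _ t₀ ht₀ himg, Finset.sum_singleton, map_mul, map_pow, map_prod, ← himg,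
    prod_image_eq_prod_of_strictMono _ t₀ ht₀, absdet_colSel_eq_of_image_eq v u ht himg.symm]

/-- **the exchange inequality for the virtual coefficients** (Grassmann–Plücker / Dress–Wenzel, non-archimedean `v`; NO hypothesis on `d`):
for `m`-sets `A`, `B` with `w_A w_B ≠ 0` and `i ∈ A \ B` some `j ∈ B \ A` has `v(w_A) v(w_B) ≤ v(w_{A−i+j}) v(w_{B−j+i})`. -/
theorem exchange_virtual (v : AbsoluteValue F ℝ) (hv : IsNonarchimedean v) (m K : ℕ) (ε : Fin K → F) (u : Fin K → Fin m → F)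
    (A B : Finset (Fin K)) (hA : A.card = m) (hB : B.card = m)
    (hA0 : (∑ t ∈ (univ : Finset (Fin m → Fin K)).filter (fun t => StrictMono t ∧ univ.image t = A),
        (∏ i, ε (t i)) * (Matrix.det (Matrix.of fun i j => u (t j) i)) ^ 2) ≠ 0)
    (hB0 : (∑ t ∈ (univ : Finset (Fin m → Fin K)).filter (fun t => StrictMono t ∧ univ.image t = B),
        (∏ i, ε (t i)) * (Matrix.det (Matrix.of fun i j => u (t j) i)) ^ 2) ≠ 0)
    (i : Fin K) (hi : i ∈ A \ B) :
    ∃ j ∈ B \ A,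
      v (∑ t ∈ (univ : Finset (Fin m → Fin K)).filter (fun t => StrictMono t ∧ univ.image t = A),
          (∏ i, ε (t i)) * (Matrix.det (Matrix.of fun i j => u (t j) i)) ^ 2)
        * v (∑ t ∈ (univ : Finset (Fin m → Fin K)).filter (fun t => StrictMono t ∧ univ.image t = B),
          (∏ i, ε (t i)) * (Matrix.det (Matrix.of fun i j => u (t j) i)) ^ 2)
      ≤ v (∑ t ∈ (univ : Finset (Fin m → Fin K)).filter (fun t => StrictMono t ∧ univ.image t = insert j (A.erase i)),
          (∏ i, ε (t i)) * (Matrix.det (Matrix.of fun i j => u (t j) i)) ^ 2)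
        * v (∑ t ∈ (univ : Finset (Fin m → Fin K)).filter (fun t => StrictMono t ∧ univ.image t = insert i (B.erase j)),
          (∏ i, ε (t i)) * (Matrix.det (Matrix.of fun i j => u (t j) i)) ^ 2) := by
  set W : Finset (Fin K) → F := fun S => ∑ t ∈ (univ : Finset (Fin m → Fin K)).filter (fun t => StrictMono t ∧ univ.image t = S),
      (∏ i, ε (t i)) * (Matrix.det (Matrix.of fun i j => u (t j) i)) ^ 2 with hW
  obtain ⟨hiA, hiB⟩ := Finset.mem_sdiff.1 hi
  obtain ⟨tA, htA, hAimg⟩ := exists_strictMono_image_eq A hA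
  obtain ⟨tB, htB, hBimg⟩ := exists_strictMono_image_eq B hB
  have hm : 0 < m := by
    rw [← hA]
    exact Finset.card_pos.2 ⟨i, hiA⟩
  have hic : i ∈ univ.image tA := hAimg.symm ▸ hiA
  obtain ⟨c, -, hc⟩ := Finset.mem_image.1 hic
  subst hc
  have hvA := absoluteValue_virtual v ε u htA.injective
  have hvB := absoluteValue_virtual v ε u htB.injective
  rw [hAimg] at hvA
  rw [hBimg] at hvB
  change v (W A) = _ at hvA
  change v (W B) = _ at hvB
  have hdetA : 0 < v (Matrix.det (Matrix.of fun r c => u (tA c) r)) := by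
    refine lt_of_le_of_ne (v.nonneg _) fun h0 => hA0 ?_
    have h1 : v (W A) = 0 := by rw [hvA, ← h0]; ring
    exact (AbsoluteValue.eq_zero v).1 h1
  have hdetB : 0 < v (Matrix.det (Matrix.of fun r c => u (tB c) r)) := by
    refine lt_of_le_of_ne (v.nonneg _) fun h0 => hB0 ?_
    have h1 : v (W B) = 0 := by rw [hvB, ← h0]; ring
    exact (AbsoluteValue.eq_zero v).1 h1
  obtain ⟨j', hj'⟩ := exists_exchange_colSel v hv hm u tA tB c
  have hjB : tB j' ∈ B := hBimg ▸ Finset.mem_image_of_mem tB (Finset.mem_univ j')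
  by_cases hjA : tB j' ∈ A
  · exfalso
    have hji : tB j' ≠ tA c := fun h => hiB (h ▸ hjB)
    have hjc : tB j' ∈ univ.image tA := hAimg.symm ▸ hjA
    obtain ⟨c₀, -, hc₀⟩ := Finset.mem_image.1 hjc
    have hc₀c : c₀ ≠ c := by
      rintro rfl
      exact hji hc₀.symm
    rw [det_colSel_update_eq_zero u tA c c₀ hc₀c (tB j') hc₀, map_zero, zero_mul] at hj'
    exact absurd hj' (not_le.2 (mul_pos hdetA hdetB))
  · refine ⟨tB j', Finset.mem_sdiff.2 ⟨hjB, hjA⟩, ?_⟩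
    have hjimg : tB j' ∉ univ.image tA := hAimg.symm ▸ hjA
    have hiimg : tA c ∉ univ.image tB := hBimg.symm ▸ hiB
    have hinjA' := update_injective htA.injective c hjimg
    have hinjB' := update_injective htB.injective j' hiimg
    have himgA' : univ.image (Function.update tA c (tB j')) = insert (tB j') (A.erase (tA c)) := by
      rw [image_update_eq htA.injective c hjimg, hAimg]
    have himgB' : univ.image (Function.update tB j' (tA c)) = insert (tA c) (B.erase (tB j')) := by
      rw [image_update_eq htB.injective j' hiimg, hBimg]
    have hvA' := absoluteValue_virtual v ε u hinjA'
    have hvB' := absoluteValue_virtual v ε u hinjB'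
    rw [himgA'] at hvA'
    rw [himgB'] at hvB'
    change v (W (insert (tB j') (A.erase (tA c)))) = _ at hvA'
    change v (W (insert (tA c) (B.erase (tB j')))) = _ at hvB'
    change v (W A) * v (W B) ≤ v (W (insert (tB j') (A.erase (tA c)))) * v (W (insert (tA c) (B.erase (tB j'))))
    rw [hvA, hvB, hvA', hvB']
    have hjA' : tB j' ∉ A.erase (tA c) := fun h => hjA (Finset.mem_of_mem_erase h)
    have hiB' : tA c ∉ B.erase (tB j') := fun h => hiB (Finset.mem_of_mem_erase h)
    have hP : (∏ l ∈ insert (tB j') (A.erase (tA c)), v (ε l)) * (∏ l ∈ insert (tA c) (B.erase (tB j')), v (ε l))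
        = (∏ l ∈ A, v (ε l)) * ∏ l ∈ B, v (ε l) := by
      rw [Finset.prod_insert hjA', Finset.prod_insert hiB', ← Finset.mul_prod_erase A (fun l => v (ε l)) hiA,
        ← Finset.mul_prod_erase B (fun l => v (ε l)) hjB]
      ring
    have hsq := pow_le_pow_left₀ (mul_nonneg (v.nonneg _) (v.nonneg _)) hj' 2
    have hPnn : 0 ≤ (∏ l ∈ A, v (ε l)) * ∏ l ∈ B, v (ε l) :=
      mul_nonneg (Finset.prod_nonneg fun l _ => v.nonneg _) (Finset.prod_nonneg fun l _ => v.nonneg _)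
    calc (∏ l ∈ A, v (ε l)) * v (Matrix.det (Matrix.of fun r c => u (tA c) r)) ^ 2
          * ((∏ l ∈ B, v (ε l)) * v (Matrix.det (Matrix.of fun r c => u (tB c) r)) ^ 2)
        = ((∏ l ∈ A, v (ε l)) * ∏ l ∈ B, v (ε l)) * (v (Matrix.det (Matrix.of fun r c => u (tA c) r))
            * v (Matrix.det (Matrix.of fun r c => u (tB c) r))) ^ 2 := by ring
      _ ≤ ((∏ l ∈ A, v (ε l)) * ∏ l ∈ B, v (ε l))
            * (v (Matrix.det (Matrix.of fun r c' => u (Function.update tA c (tB j') c') r))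
              * v (Matrix.det (Matrix.of fun r c' => u (Function.update tB j' (tA c) c') r))) ^ 2 :=
          mul_le_mul_of_nonneg_left hsq hPnn
      _ = _ := by rw [← hP]; ring

/-! ## §2 The actual coefficients are class sums of virtual coefficients -/

/-- **`c_E = Σ_{#S = m, E(S) = E} w_S`**: the coefficient of `X^E` in the rank-one lacunary determinant is the sum of the virtual
coefficients over the `m`-sets of exponent `E` (Cauchy–Binet regrouped by the selected set). [bookkeeping on `det_rankOnePencil`] -/
theorem coeff_eq_sum_virtual (m K : ℕ) (d : Fin K → ℕ) (ε : Fin K → F) (u : Fin K → Fin m → F) (E : ℕ) :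
    (Matrix.det (∑ l, ((X : F[X]) ^ d l) • (ε l • Matrix.vecMulVec (u l) (u l)).map (C : F →+* F[X]))).coeff E
      = ∑ S ∈ (univ : Finset (Finset (Fin K))).filter (fun S => S.card = m ∧ ∑ l ∈ S, d l = E),
          ∑ t ∈ (univ : Finset (Fin m → Fin K)).filter (fun t => StrictMono t ∧ univ.image t = S),
            (∏ i, ε (t i)) * (Matrix.det (Matrix.of fun i j => u (t j) i)) ^ 2 := by
  rw [det_rankOnePencil, Polynomial.finsetSum_coeff]
  simp only [Polynomial.coeff_C_mul_X_pow]
  rw [← Finset.sum_filter]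
  -- regroup the selections of exponent E by their image
  have hmaps : ∀ t ∈ ((univ : Finset (Fin m → Fin K)).filter fun t => StrictMono t).filter (fun t => E = ∑ i, d (t i)),
      univ.image t ∈ (univ : Finset (Finset (Fin K))).filter (fun S => S.card = m ∧ ∑ l ∈ S, d l = E) := by
    intro t ht
    rw [Finset.mem_filter, Finset.mem_filter] at ht
    obtain ⟨⟨-, hmono⟩, hE⟩ := ht
    refine Finset.mem_filter.2 ⟨Finset.mem_univ _, ?_, ?_⟩
    · rw [Finset.card_image_of_injective _ hmono.injective, Finset.card_univ, Fintype.card_fin]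
    · rw [sum_image_eq_sum_of_strictMono d t hmono, hE]
  rw [← Finset.sum_fiberwise_of_maps_to hmaps]
  refine Finset.sum_congr rfl fun S hS => ?_
  obtain ⟨-, hScard, hSE⟩ := Finset.mem_filter.1 hS
  refine Finset.sum_congr ?_ fun t _ => rfl
  ext t
  simp only [Finset.mem_filter, Finset.mem_univ, true_and]
  constructor
  · rintro ⟨⟨hmono, -⟩, himg⟩
    exact ⟨hmono, himg⟩
  · rintro ⟨hmono, himg⟩
    refine ⟨⟨hmono, ?_⟩, himg⟩
    rw [← sum_image_eq_sum_of_strictMono d t hmono, himg, hSE]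

/-! ## §3 Ultrametric class sums -/

/-- an ultrametric sum is bounded by a common bound of its terms. [folklore] -/
theorem abv_sum_le_of_forall_le (v : AbsoluteValue F ℝ) (hv : IsNonarchimedean v) {ι : Type*} (s : Finset ι) (g : ι → F)
    {B : ℝ} (hB : 0 ≤ B) (h : ∀ i ∈ s, v (g i) ≤ B) : v (∑ i ∈ s, g i) ≤ B := by
  rcases s.eq_empty_or_nonempty with rfl | hne
  · rw [Finset.sum_empty, map_zero]; exact hB
  · obtain ⟨b, hb, hle⟩ := IsNonarchimedean.finset_image_add_of_nonempty hv g hne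
    exact hle.trans (h b hb)

/-- **no cancellation at a unique maximum:** if one term strictly dominates all others, the ultrametric sum has its size. [folklore] -/
theorem abv_sum_eq_of_unique_max (v : AbsoluteValue F ℝ) (hv : IsNonarchimedean v) {ι : Type*} (s : Finset ι) (g : ι → F)
    {i₀ : ι} (hi₀ : i₀ ∈ s) (h : ∀ i ∈ s, i ≠ i₀ → v (g i) < v (g i₀)) : v (∑ i ∈ s, g i) = v (g i₀) := by
  rw [← Finset.add_sum_erase s g hi₀]
  rcases (s.erase i₀).eq_empty_or_nonempty with he | hne
  · rw [he, Finset.sum_empty, add_zero]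
  · obtain ⟨b, hb, hle⟩ := IsNonarchimedean.finset_image_add_of_nonempty hv g hne
    have hlt : v (∑ i ∈ s.erase i₀, g i) < v (g i₀) :=
      hle.trans_lt (h b (Finset.mem_of_mem_erase hb) (Finset.ne_of_mem_erase hb))
    rw [IsNonarchimedean.add_eq_max_of_ne' v hv (fun a => (v.map_neg a).symm) hlt.ne', max_eq_left hlt.le]

end Summit.ValiantsHypothesis.ValiantsHypothesis.Theorems.KPlusLogSqLaw.ValDoor
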